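import Summits.AtomisticToContinuum.BoseEinsteinCondensation.Theorems.BECConjugateDominationPuffFloorSolidCore

/-!
# Route `BECConjugateDomination`, crux `PuffFloor` (stmt-AtomisticToContinuum-11785),
# line `coupling-slope-pocket`: the Puff pair moment is controlled by the energy plus the close-pair COUNT

Supports (does not close) stmt-AtomisticToContinuum-11785. The only open stub of the line is the coreless
residual S7 (`stub_corelessPairMoment`): for smooth-class `v` with `v 0 = 0`, the Puff pair functional
`P(Ψ) = ∫_{Λᴺ} ∑_{i<j} W^per(xᵢ − xⱼ)|Ψ|²`, `W(r) = r²‖D²ṽ(r e₀)‖`, of the positive exact minimiser is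
`O(ρN)`. This file removes Puff's Hessian weight from the residual: by the edge condition
`‖D²ṽ‖ ≤ Cₑ√ṽ`, `2ab ≤ a² + b²` and `D²ṽ = 0` off the support,
`W(r) ≤ D₀ (v(r) + 1_{r ≤ R₀})` for `r ≥ 0` (`puffWeight_le`, NO positive core needed), hence for EVERY
periodic trial state `P(Ψ) ≤ D₀ (⟨Ψ, H(v)Ψ⟩ + E_Ψ #{i<j : |xᵢ − xⱼ|_per ≤ R₀})`
(`lintegral_puffWeight_le`), and with the Born bound `E₀^per ≤ ‖ṽ‖₁ρN` at the minimiser the pair-moment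
bound S7 follows from the plain close-pair COUNT bound `E_Ψ #{i<j : |xᵢ − xⱼ|_per ≤ R₀} ≤ C_N ρ N`
(`pairMoment_of_pairCount`) — the planner's original `PairCountBound`, which becomes the line's reshaped
stub S7′ `stub_corelessPairCount`. Elementary (pointwise profile inequality, linearity/monotonicity of the
periodisation in the profile on non-negative arguments, `lintegral` bookkeeping).

References: Puff1965; Stringari1995 §2.3 (22); LSSY2005 Ch. 2 (Born bound by the constant state);
`Cruxes/PuffFloor/Lines/coupling_slope_pocket.lean` (registered skeleton), `Cruxes/PuffFloor/NOTES.md`.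
-/

noncomputable section

namespace Summit.AtomisticToContinuum.BoseEinsteinCondensation.Theorems

open MeasureTheory Filter
open scoped ENNReal NNReal BigOperators
open Literature.MathematicalPhysics.QuantumManyBody.BoseGas
open Summit.AtomisticToContinuum.BoseEinsteinCondensation.Theses.BECConjugateDomination

namespace PuffFloorPairMomentOfPairCount

/-! ## The Puff weight against `v + 1_{[0,R₀]}` — no core needed -/

/-- **Profile bound without a core.** For a finite profile `v` with `ṽ(x) = v(|x|)` of class `C²`,
edge condition `‖D²ṽ‖ ≤ Cₑ√ṽ` and range `R₀`: `r²‖D²ṽ(r e₀)‖ ≤ D₀ (v(r) + 1_{r ≤ R₀})` for every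
`r ≥ 0`, with `D₀ = R₀⁴ max(Cₑ,1)² + 1` — from `r²‖D²ṽ(re₀)‖ ≤ R₀² Cₑ √v(r)` for `r ≤ R₀`,
`2ab ≤ a² + b²`, and `D²ṽ(r e₀) = 0` for `r > R₀` (`ṽ` vanishes on the open set `{|y| > R₀}`).
Adapted from `PocketClassicalStability.profile_bounds` (same computation at `t = 1`, core dropped). [folklore] -/
theorem puffWeight_real_le (v : ℝ → ℝ≥0∞)
    (hC2 : ContDiff ℝ 2 (fun x : Space => (v ‖x‖).toReal)) (Cₑ : ℝ)
    (hCₑ : ∀ x : Space, ‖iteratedFDeriv ℝ 2 (fun x : Space => (v ‖x‖).toReal) x‖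
      ≤ Cₑ * Real.sqrt ((v ‖x‖).toReal))
    (R₀ : ℝ) (hrange : ∀ r, R₀ < r → v r = 0) :
    ∃ D₀ : ℝ, 0 < D₀ ∧ ∀ r, 0 ≤ r →
      r ^ 2 * ‖iteratedFDeriv ℝ 2 (fun x : Space => (v ‖x‖).toReal)
            (r • EuclideanSpace.single (0 : Fin 3) (1 : ℝ))‖
        ≤ D₀ * ((v r).toReal + (if r ≤ R₀ then 1 else 0)) := by
  set vt : Space → ℝ := fun x => (v ‖x‖).toReal with hvt
  set e₀ : Space := EuclideanSpace.single (0 : Fin 3) (1 : ℝ) with he₀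
  have _hC2' := hC2
  have hnorm : ∀ r : ℝ, ‖r • e₀‖ = |r| := fun r => by
    rw [norm_smul, he₀, PiLp.norm_single, norm_one, mul_one, Real.norm_eq_abs]
  have hvt_ray : ∀ r, 0 ≤ r → vt (r • e₀) = (v r).toReal := fun r hr => by
    simp only [hvt]
    rw [hnorm, abs_of_nonneg hr]
  set C := max Cₑ 1 with hC
  have hedgeC : ∀ x, ‖iteratedFDeriv ℝ 2 vt x‖ ≤ C * Real.sqrt (vt x) := fun x =>
    (hCₑ x).trans (mul_le_mul_of_nonneg_right (le_max_left _ _) (Real.sqrt_nonneg _))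
  -- the second derivative vanishes outside the range
  have hD0 : ∀ r, R₀ < r → iteratedFDeriv ℝ 2 vt (r • e₀) = 0 := by
    intro r hr
    have hopen : IsOpen {y : Space | R₀ < ‖y‖} := isOpen_lt continuous_const continuous_norm
    have hmem : r • e₀ ∈ {y : Space | R₀ < ‖y‖} := by
      show R₀ < ‖r • e₀‖
      rw [hnorm]
      exact hr.trans_le (le_abs_self r)
    have hev : vt =ᶠ[nhds (r • e₀)] fun _ => (0 : ℝ) :=
      Filter.eventually_of_mem (hopen.mem_nhds hmem) fun y hy => by
        show (v ‖y‖).toReal = 0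
        rw [hrange _ hy, ENNReal.toReal_zero]
    rw [(hev.iteratedFDeriv ℝ 2).eq_of_nhds, iteratedFDeriv_fun_zero]
    rfl
  refine ⟨R₀ ^ 4 * C ^ 2 + 1, by positivity, ?_⟩
  intro r hr0
  have hv0 : 0 ≤ (v r).toReal := ENNReal.toReal_nonneg
  by_cases hr : r ≤ R₀
  · rw [if_pos hr]
    have h1 : ‖iteratedFDeriv ℝ 2 vt (r • e₀)‖ ≤ C * Real.sqrt ((v r).toReal) := by
      have := hedgeC (r • e₀)
      rwa [hvt_ray r hr0] at this
    have h2 : r ^ 2 ≤ R₀ ^ 2 := pow_le_pow_left₀ hr0 hr 2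
    have hs := Real.sq_sqrt hv0
    have h3 : r ^ 2 * ‖iteratedFDeriv ℝ 2 vt (r • e₀)‖ ≤ R₀ ^ 2 * (C * Real.sqrt ((v r).toReal)) :=
      mul_le_mul h2 h1 (norm_nonneg _) (sq_nonneg _)
    have key : R₀ ^ 2 * (C * Real.sqrt ((v r).toReal))
        ≤ Real.sqrt ((v r).toReal) ^ 2 / 4 + (R₀ ^ 4 * C ^ 2 + 1) := by
      nlinarith [sq_nonneg (Real.sqrt ((v r).toReal) - 2 * R₀ ^ 2 * C)]
    have hD1 : (1 : ℝ) ≤ R₀ ^ 4 * C ^ 2 + 1 := by nlinarith [sq_nonneg (R₀ ^ 2 * C)]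
    calc r ^ 2 * ‖iteratedFDeriv ℝ 2 vt (r • e₀)‖
        ≤ R₀ ^ 2 * (C * Real.sqrt ((v r).toReal)) := h3
      _ ≤ Real.sqrt ((v r).toReal) ^ 2 / 4 + (R₀ ^ 4 * C ^ 2 + 1) := key
      _ = (v r).toReal / 4 + (R₀ ^ 4 * C ^ 2 + 1) := by rw [hs]
      _ ≤ (R₀ ^ 4 * C ^ 2 + 1) * ((v r).toReal + 1) := by nlinarith
  · rw [if_neg hr, add_zero, hD0 r (not_le.1 hr), norm_zero, mul_zero]
    positivity

/-- `ENNReal` form of `puffWeight_real_le`: `W(r) ≤ D₀ · (v(r) + 1_{(-∞,R₀]}(r))` for `r ≥ 0`, where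
`W(r) = ofReal (r²‖D²ṽ(r e₀)‖)` is the Puff weight profile of the line. [folklore] -/
theorem puffWeight_le (v : ℝ → ℝ≥0∞) (hfin : ∀ r, v r ≠ ⊤)
    (hC2 : ContDiff ℝ 2 (fun x : Space => (v ‖x‖).toReal)) (Cₑ : ℝ)
    (hCₑ : ∀ x : Space, ‖iteratedFDeriv ℝ 2 (fun x : Space => (v ‖x‖).toReal) x‖
      ≤ Cₑ * Real.sqrt ((v ‖x‖).toReal))
    (R₀ : ℝ) (hrange : ∀ r, R₀ < r → v r = 0) :
    ∃ D₀ : ℝ, 0 < D₀ ∧ ∀ r, 0 ≤ r →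
      ENNReal.ofReal (r ^ 2 * ‖iteratedFDeriv ℝ 2 (fun x : Space => (v ‖x‖).toReal)
            (r • EuclideanSpace.single (0 : Fin 3) (1 : ℝ))‖)
        ≤ ENNReal.ofReal D₀ * (v r + Set.indicator (Set.Iic R₀) (fun _ : ℝ => (1 : ℝ≥0∞)) r) := by
  obtain ⟨D₀, hD₀, h⟩ := puffWeight_real_le v hC2 Cₑ hCₑ R₀ hrange
  refine ⟨D₀, hD₀, fun r hr => ?_⟩
  have hind : Set.indicator (Set.Iic R₀) (fun _ : ℝ => (1 : ℝ≥0∞)) r =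
      ENNReal.ofReal (if r ≤ R₀ then 1 else 0) := by
    by_cases hr' : r ≤ R₀
    · rw [Set.indicator_of_mem (show r ∈ Set.Iic R₀ from hr'), if_pos hr', ENNReal.ofReal_one]
    · rw [Set.indicator_of_notMem (show r ∉ Set.Iic R₀ from hr'), if_neg hr', ENNReal.ofReal_zero]
  calc ENNReal.ofReal (r ^ 2 * ‖iteratedFDeriv ℝ 2 (fun x : Space => (v ‖x‖).toReal)
            (r • EuclideanSpace.single (0 : Fin 3) (1 : ℝ))‖)
      ≤ ENNReal.ofReal (D₀ * ((v r).toReal + (if r ≤ R₀ then 1 else 0))) :=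
        ENNReal.ofReal_le_ofReal (h r hr)
    _ = ENNReal.ofReal D₀ * (v r + Set.indicator (Set.Iic R₀) (fun _ : ℝ => (1 : ℝ≥0∞)) r) := by
        have h1 : (0 : ℝ) ≤ (if r ≤ R₀ then 1 else 0) := by split_ifs <;> norm_num
        rw [ENNReal.ofReal_mul hD₀.le, ENNReal.ofReal_add ENNReal.toReal_nonneg h1,
          ENNReal.ofReal_toReal (hfin r), hind]

/-! ## Periodisation: monotone and linear in the profile (non-negative arguments only) -/

/-- The periodisation only reads the profile at non-negative arguments, so a comparison of profiles on
`[0, ∞)` periodises. [folklore] -/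
theorem periodizedPotential_mono_nonneg {w u : ℝ → ℝ≥0∞} (h : ∀ r, 0 ≤ r → w r ≤ u r) (L : ℝ)
    (x : Space) : periodizedPotential w L x ≤ periodizedPotential u L x :=
  ENNReal.tsum_le_tsum fun _ => h _ (norm_nonneg _)

/-- Additivity of the periodisation in the profile. [folklore] -/
theorem periodizedPotential_add (w u : ℝ → ℝ≥0∞) (L : ℝ) (x : Space) :
    periodizedPotential (fun r => w r + u r) L x = periodizedPotential w L x + periodizedPotential u L x :=
  ENNReal.tsum_add

/-- Homogeneity of the periodisation in the profile. [folklore] -/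
theorem periodizedPotential_const_mul (c : ℝ≥0∞) (w : ℝ → ℝ≥0∞) (L : ℝ) (x : Space) :
    periodizedPotential (fun r => c * w r) L x = c * periodizedPotential w L x :=
  ENNReal.tsum_mul_left

/-- Comparison of profiles on `[0, ∞)` ⇒ comparison of periodic interactions. [folklore] -/
theorem periodicInteraction_mono_nonneg {N : ℕ} {w u : ℝ → ℝ≥0∞} (h : ∀ r, 0 ≤ r → w r ≤ u r)
    (L : ℝ) (X : Config N) : periodicInteraction w L X ≤ periodicInteraction u L X :=
  Finset.sum_le_sum fun _ _ => Finset.sum_le_sum fun _ _ => periodizedPotential_mono_nonneg h L _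

/-- Additivity of the periodic interaction in the profile. [folklore] -/
theorem periodicInteraction_add {N : ℕ} (w u : ℝ → ℝ≥0∞) (L : ℝ) (X : Config N) :
    periodicInteraction (fun r => w r + u r) L X = periodicInteraction w L X + periodicInteraction u L X := by
  simp only [periodicInteraction, periodizedPotential_add, Finset.sum_add_distrib]

/-- Homogeneity of the periodic interaction in the profile. [folklore] -/
theorem periodicInteraction_const_mul {N : ℕ} (c : ℝ≥0∞) (w : ℝ → ℝ≥0∞) (L : ℝ) (X : Config N) :
    periodicInteraction (fun r => c * w r) L X = c * periodicInteraction w L X := by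
  simp only [periodicInteraction, periodizedPotential_const_mul, Finset.mul_sum]

/-- Measurability of the periodised potential of a measurable profile. [folklore] -/
private theorem measurable_periodizedPotential_pm {v : ℝ → ℝ≥0∞} (hv : Measurable v) (L : ℝ) :
    Measurable (periodizedPotential v L) := by
  show Measurable fun x => ∑' n : Fin 3 → ℤ, v ‖x - latticeVec L n‖
  exact Measurable.tsum fun n => hv.comp (measurable_id.sub_const _).norm

/-- Measurability of the periodic pair interaction of a measurable profile. [folklore] -/
private theorem measurable_periodicInteraction_pm {N : ℕ} {v : ℝ → ℝ≥0∞} (hv : Measurable v)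
    (L : ℝ) : Measurable fun X : Config N => periodicInteraction v L X := by
  unfold periodicInteraction
  refine Finset.measurable_sum _ fun i _ => Finset.measurable_sum _ fun j _ => ?_
  exact (measurable_periodizedPotential_pm hv L).comp
    ((measurable_pi_apply i).sub (measurable_pi_apply j))

/-! ## The pair moment against energy plus pair count, state by state -/

/-- **`P(Ψ) ≤ D₀ (⟨Ψ,H(v)Ψ⟩ + E_Ψ #{i<j : |xᵢ − xⱼ|_per ≤ R₀})` for every periodic trial state**, with the
`D₀` of `puffWeight_le` (smooth finite `v` with the edge condition and range `R₀`; no core, no minimality).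
[folklore] -/
theorem lintegral_puffWeight_le (v : ℝ → ℝ≥0∞) (hv : IsRepulsiveFiniteRange v) (hfin : ∀ r, v r ≠ ⊤)
    (hC2 : ContDiff ℝ 2 (fun x : Space => (v ‖x‖).toReal))
    (hedge : ∃ Cₑ : ℝ, ∀ x : Space, ‖iteratedFDeriv ℝ 2 (fun x : Space => (v ‖x‖).toReal) x‖
        ≤ Cₑ * Real.sqrt ((v ‖x‖).toReal))
    {R₀ : ℝ} (hrange : ∀ r, R₀ < r → v r = 0) :
    ∃ D₀ : ℝ, 0 < D₀ ∧ ∀ (N : ℕ) (L : ℝ) (Ψ : PeriodicTrialState N L),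
      (∫⁻ X in cellN N L,
          periodicInteraction (fun r : ℝ => ENNReal.ofReal (r ^ 2 *
            ‖iteratedFDeriv ℝ 2 (fun x : Space => (v ‖x‖).toReal)
              (r • EuclideanSpace.single (0 : Fin 3) (1 : ℝ))‖)) L X * (‖Ψ.ψ X‖₊ : ℝ≥0∞) ^ 2)
        ≤ ENNReal.ofReal D₀ * (periodicEnergy v Ψ +
            ∫⁻ X in cellN N L,
              periodicInteraction (Set.indicator (Set.Iic R₀) (fun _ : ℝ => (1 : ℝ≥0∞))) L X *
                (‖Ψ.ψ X‖₊ : ℝ≥0∞) ^ 2) := by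
  obtain ⟨Cₑ, hCₑ⟩ := hedge
  obtain ⟨D₀, hD₀, hW⟩ := puffWeight_le v hfin hC2 Cₑ hCₑ R₀ hrange
  refine ⟨D₀, hD₀, fun N L Ψ => ?_⟩
  set ind : ℝ → ℝ≥0∞ := Set.indicator (Set.Iic R₀) (fun _ : ℝ => (1 : ℝ≥0∞)) with hind
  have hmeas_ind : Measurable ind := measurable_const.indicator measurableSet_Iic
  have hΨ2 : Measurable fun X : Config N => (‖Ψ.ψ X‖₊ : ℝ≥0∞) ^ 2 :=
    (Ψ.contDiff.continuous.measurable.nnnorm.coe_nnreal_ennreal).pow_const 2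
  have hA : Measurable fun X : Config N => periodicInteraction v L X * (‖Ψ.ψ X‖₊ : ℝ≥0∞) ^ 2 :=
    (measurable_periodicInteraction_pm hv.1 L).mul hΨ2
  -- pointwise comparison of the interactions
  have hpt : ∀ X : Config N,
      periodicInteraction (fun r : ℝ => ENNReal.ofReal (r ^ 2 *
          ‖iteratedFDeriv ℝ 2 (fun x : Space => (v ‖x‖).toReal)
            (r • EuclideanSpace.single (0 : Fin 3) (1 : ℝ))‖)) L X
        ≤ ENNReal.ofReal D₀ * (periodicInteraction v L X + periodicInteraction ind L X) := by
    intro X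
    calc periodicInteraction (fun r : ℝ => ENNReal.ofReal (r ^ 2 *
            ‖iteratedFDeriv ℝ 2 (fun x : Space => (v ‖x‖).toReal)
              (r • EuclideanSpace.single (0 : Fin 3) (1 : ℝ))‖)) L X
        ≤ periodicInteraction (fun r : ℝ => ENNReal.ofReal D₀ * (v r + ind r)) L X :=
          periodicInteraction_mono_nonneg (fun r hr => hW r hr) L X
      _ = ENNReal.ofReal D₀ * (periodicInteraction v L X + periodicInteraction ind L X) := by
          rw [periodicInteraction_const_mul, periodicInteraction_add]
  calc (∫⁻ X in cellN N L,
          periodicInteraction (fun r : ℝ => ENNReal.ofReal (r ^ 2 *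
            ‖iteratedFDeriv ℝ 2 (fun x : Space => (v ‖x‖).toReal)
              (r • EuclideanSpace.single (0 : Fin 3) (1 : ℝ))‖)) L X * (‖Ψ.ψ X‖₊ : ℝ≥0∞) ^ 2)
      ≤ ∫⁻ X in cellN N L, ENNReal.ofReal D₀ *
          (periodicInteraction v L X * (‖Ψ.ψ X‖₊ : ℝ≥0∞) ^ 2 +
            periodicInteraction ind L X * (‖Ψ.ψ X‖₊ : ℝ≥0∞) ^ 2) := by
        refine lintegral_mono fun X => ?_
        calc _ ≤ ENNReal.ofReal D₀ * (periodicInteraction v L X + periodicInteraction ind L X) *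
              (‖Ψ.ψ X‖₊ : ℝ≥0∞) ^ 2 := by gcongr; exact hpt X
          _ = _ := by ring
    _ = ENNReal.ofReal D₀ * ((∫⁻ X in cellN N L, periodicInteraction v L X * (‖Ψ.ψ X‖₊ : ℝ≥0∞) ^ 2) +
          ∫⁻ X in cellN N L, periodicInteraction ind L X * (‖Ψ.ψ X‖₊ : ℝ≥0∞) ^ 2) := by
        rw [lintegral_const_mul' _ _ ENNReal.ofReal_ne_top, lintegral_add_left hA]
    _ ≤ ENNReal.ofReal D₀ * (periodicEnergy v Ψ +
          ∫⁻ X in cellN N L, periodicInteraction ind L X * (‖Ψ.ψ X‖₊ : ℝ≥0∞) ^ 2) := by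
        gcongr
        exact lintegral_mono fun X => le_add_self

/-! ## S7 from S7′: the coreless pair MOMENT bound from the close-pair COUNT bound -/

/-- **Reduction of the line's residual stub S7 (`stub_corelessPairMoment`) to the close-pair count S7′.**
If, for the exact positive `C³` minimisers at density `ρ < ρ₁`, eventually in `n`, the expected number of
pairs at torus distance `≤ R₀` is `≤ C_N ρ (n+1)`, then Puff's pair functional is `≤ C_P ρ (n+1)` with
`C_P = D₀ (‖ṽ‖₁ + C_N)`: `lintegral_puffWeight_le` at the minimiser plus the Born bound
`E₀^per(n+1, L_{n+1}(ρ)) ≤ ‖ṽ‖₁ ρ (n+1)` (`PuffFloorSolidCore.bornEnergyBound`). The hypotheses on `Ψ`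
are passed through verbatim; only exact minimality is consumed (for the energy bound). [folklore] -/
theorem pairMoment_of_pairCount (v : ℝ → ℝ≥0∞) (hv : IsRepulsiveFiniteRange v) (hfin : ∀ r, v r ≠ ⊤)
    (hC2 : ContDiff ℝ 2 (fun x : Space => (v ‖x‖).toReal))
    (hedge : ∃ Cₑ : ℝ, ∀ x : Space, ‖iteratedFDeriv ℝ 2 (fun x : Space => (v ‖x‖).toReal) x‖
        ≤ Cₑ * Real.sqrt ((v ‖x‖).toReal))
    {R₀ : ℝ} (hrange : ∀ r, R₀ < r → v r = 0)
    (hcount : ∃ C_N : ℝ, 0 ≤ C_N ∧ ∃ ρ₁ : ℝ, 0 < ρ₁ ∧ ∀ ρ : ℝ, 0 < ρ → ρ < ρ₁ → ∀ᶠ n : ℕ in atTop,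
        ∀ Ψ : PeriodicTrialState (n + 1) (sideLength ρ (n + 1)), ContDiff ℝ 3 Ψ.ψ →
          periodicEnergy v Ψ = periodicGroundStateEnergy v (n + 1) (sideLength ρ (n + 1)) →
          periodicEnergy v Ψ ≠ ⊤ → (∀ X, Ψ.ψ X = (‖Ψ.ψ X‖ : ℂ)) → (∀ X, Ψ.ψ X ≠ 0) →
          (∫⁻ X in cellN (n + 1) (sideLength ρ (n + 1)),
              periodicInteraction (Set.indicator (Set.Iic R₀) (fun _ : ℝ => (1 : ℝ≥0∞)))
                (sideLength ρ (n + 1)) X * (‖Ψ.ψ X‖₊ : ℝ≥0∞) ^ 2)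
            ≤ ENNReal.ofReal (C_N * ρ * ((n : ℝ) + 1))) :
    ∃ C_P : ℝ, 0 ≤ C_P ∧ ∃ ρ₁ : ℝ, 0 < ρ₁ ∧ ∀ ρ : ℝ, 0 < ρ → ρ < ρ₁ → ∀ᶠ n : ℕ in atTop,
        ∀ Ψ : PeriodicTrialState (n + 1) (sideLength ρ (n + 1)), ContDiff ℝ 3 Ψ.ψ →
          periodicEnergy v Ψ = periodicGroundStateEnergy v (n + 1) (sideLength ρ (n + 1)) →
          periodicEnergy v Ψ ≠ ⊤ → (∀ X, Ψ.ψ X = (‖Ψ.ψ X‖ : ℂ)) → (∀ X, Ψ.ψ X ≠ 0) →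
          (∫⁻ X in cellN (n + 1) (sideLength ρ (n + 1)),
              periodicInteraction (fun r : ℝ => ENNReal.ofReal (r ^ 2 *
                ‖iteratedFDeriv ℝ 2 (fun x : Space => (v ‖x‖).toReal)
                  (r • EuclideanSpace.single (0 : Fin 3) (1 : ℝ))‖)) (sideLength ρ (n + 1)) X *
                (‖Ψ.ψ X‖₊ : ℝ≥0∞) ^ 2)
            ≤ ENNReal.ofReal (C_P * ρ * ((n : ℝ) + 1)) := by
  obtain ⟨D₀, hD₀, hPW⟩ := lintegral_puffWeight_le v hv hfin hC2 hedge hrange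
  obtain ⟨CE, hCE0, hCE⟩ := PuffFloorSolidCore.bornEnergyBound v hv hfin hC2
  obtain ⟨CN, hCN0, ρ₁, hρ₁, hN⟩ := hcount
  refine ⟨D₀ * (CE + CN), by positivity, ρ₁, hρ₁, fun ρ hρ hρ₁' => ?_⟩
  filter_upwards [hN ρ hρ hρ₁'] with n hn Ψ hC3 hmin hfinE hreal hne
  have hLpos : 0 < sideLength ρ (n + 1) := by
    unfold sideLength
    apply Real.rpow_pos_of_pos
    positivity
  have hE : periodicEnergy v Ψ ≤ ENNReal.ofReal (CE * ρ * ((n : ℝ) + 1)) := by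
    rw [hmin, ← PuffFloorSolidCore.const_mul_sq_div_sideLength_cube hρ CE n]
    exact hCE n (sideLength ρ (n + 1)) hLpos
  have hcnt := hn Ψ hC3 hmin hfinE hreal hne
  calc _ ≤ ENNReal.ofReal D₀ * (periodicEnergy v Ψ +
          ∫⁻ X in cellN (n + 1) (sideLength ρ (n + 1)),
            periodicInteraction (Set.indicator (Set.Iic R₀) (fun _ : ℝ => (1 : ℝ≥0∞)))
              (sideLength ρ (n + 1)) X * (‖Ψ.ψ X‖₊ : ℝ≥0∞) ^ 2) := hPW (n + 1) _ Ψ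
    _ ≤ ENNReal.ofReal D₀ * (ENNReal.ofReal (CE * ρ * ((n : ℝ) + 1)) +
          ENNReal.ofReal (CN * ρ * ((n : ℝ) + 1))) := by gcongr
    _ = ENNReal.ofReal (D₀ * (CE + CN) * ρ * ((n : ℝ) + 1)) := by
        rw [← ENNReal.ofReal_add (by positivity) (by positivity), ← ENNReal.ofReal_mul hD₀.le]
        congr 1
        ring

end PuffFloorPairMomentOfPairCount

/-- **Stub S7r `stub_pairMomentOfPairCount` of the registered skeleton of line `coupling-slope-pocket`
(crux stmt-AtomisticToContinuum-11785), verbatim**: for a smooth-class `v` with range parameter `R₀`, the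
close-pair COUNT bound `E_Ψ #{i<j : |xᵢ−xⱼ|_per ≤ R₀} ≤ C_N ρ (n+1)` for the exact positive `C³` minimisers
(eventually in `n`, `ρ < ρ₁`) implies the Puff pair MOMENT bound `∫∑_{i<j}W^per(xᵢ−xⱼ)|Ψ|² ≤ C_P ρ (n+1)`,
`W(r) = r²‖D²ṽ(re₀)‖` — `PuffFloorPairMomentOfPairCount.pairMoment_of_pairCount`. Sources: Puff1965;
Stringari1995 §2.3 (22); LSSY2005 Ch. 2 (Born bound). -/
theorem stub_pairMomentOfPairCount :
    ∀ v : ℝ → ℝ≥0∞, IsRepulsiveFiniteRange v → (∀ r, v r ≠ ⊤) →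
      ContDiff ℝ 2 (fun x : Space => (v ‖x‖).toReal) →
      (∃ Cₑ : ℝ, ∀ x : Space, ‖iteratedFDeriv ℝ 2 (fun x : Space => (v ‖x‖).toReal) x‖
          ≤ Cₑ * Real.sqrt ((v ‖x‖).toReal)) →
      ∀ R₀ : ℝ, (∀ r, R₀ < r → v r = 0) →
      (∃ C_N : ℝ, 0 ≤ C_N ∧ ∃ ρ₁ : ℝ, 0 < ρ₁ ∧ ∀ ρ : ℝ, 0 < ρ → ρ < ρ₁ → ∀ᶠ n : ℕ in Filter.atTop,
        ∀ Ψ : PeriodicTrialState (n + 1) (sideLength ρ (n + 1)), ContDiff ℝ 3 Ψ.ψ →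
          periodicEnergy v Ψ = periodicGroundStateEnergy v (n + 1) (sideLength ρ (n + 1)) →
          periodicEnergy v Ψ ≠ ⊤ → (∀ X, Ψ.ψ X = (‖Ψ.ψ X‖ : ℂ)) → (∀ X, Ψ.ψ X ≠ 0) →
          (∫⁻ X in cellN (n + 1) (sideLength ρ (n + 1)),
              periodicInteraction (Set.indicator (Set.Iic R₀) (fun _ : ℝ => (1 : ℝ≥0∞)))
                (sideLength ρ (n + 1)) X * (‖Ψ.ψ X‖₊ : ℝ≥0∞) ^ 2)
            ≤ ENNReal.ofReal (C_N * ρ * ((n : ℝ) + 1))) →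
      ∃ C_P : ℝ, 0 ≤ C_P ∧ ∃ ρ₁ : ℝ, 0 < ρ₁ ∧ ∀ ρ : ℝ, 0 < ρ → ρ < ρ₁ → ∀ᶠ n : ℕ in Filter.atTop,
        ∀ Ψ : PeriodicTrialState (n + 1) (sideLength ρ (n + 1)), ContDiff ℝ 3 Ψ.ψ →
          periodicEnergy v Ψ = periodicGroundStateEnergy v (n + 1) (sideLength ρ (n + 1)) →
          periodicEnergy v Ψ ≠ ⊤ → (∀ X, Ψ.ψ X = (‖Ψ.ψ X‖ : ℂ)) → (∀ X, Ψ.ψ X ≠ 0) →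
          (∫⁻ X in cellN (n + 1) (sideLength ρ (n + 1)),
              periodicInteraction (fun r : ℝ => ENNReal.ofReal (r ^ 2 *
                ‖iteratedFDeriv ℝ 2 (fun x : Space => (v ‖x‖).toReal)
                  (r • EuclideanSpace.single (0 : Fin 3) (1 : ℝ))‖)) (sideLength ρ (n + 1)) X *
                (‖Ψ.ψ X‖₊ : ℝ≥0∞) ^ 2)
            ≤ ENNReal.ofReal (C_P * ρ * ((n : ℝ) + 1)) :=
  fun v hv hfin hC2 hedge _R₀ hrange hcount =>
    PuffFloorPairMomentOfPairCount.pairMoment_of_pairCount v hv hfin hC2 hedge hrange hcount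

end Summit.AtomisticToContinuum.BoseEinsteinCondensation.Theorems

end
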